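import Literature.AlgebraicGeometry.Frobenioids.PerfectionOps
import HarnessLib

/-!
# Frobenioids I, Def. 3.1 (iii): "this datum IS the perfection `C^pf`" — the characterising predicate on
# the interface `PerfectionData`

Mochizuki, *The geometry of Frobenioids I: the general theory*, Kyushu J. Math. **62** (2008) 293–400,
Definition 3.1 (iii) p. 57 and Proposition 3.2 (i) p. 58 [cite: MochizukiFrdI2008, Def. 3.1 (iii) p.57].

`PerfectionData S` (`BaseCategoryTheoreticityDefs.lean`, seat abc-iut-L1-t3) is a data-only interface
(a category `C^pf`, the functor `C → C^pf`, the roots `(A, n)`, operations over `D`); statements over it are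
SCHEMAS, faithful to print only when the datum is THE perfection. THE perfection of a Frobenioid
`F : C → F_Φ` has been CONSTRUCTED by abc-iut-L1-d9 (`PreFrobenioidData.perfection hF`, `PerfectionOps.lean`).
This file supplies the honest link promised in the cell's ruling W2-8 (2): the predicate
`PerfectionData.IsThePerfection hF P` — `P` is equivalent, compatibly with `C → C^pf`, the roots, `Base`,
`deg_Fr`, the divisor monoids and `Div`, to the constructed perfection — and the PROVED instance
`isThePerfection_perfection`. A schema `T P` is asserted by print exactly for the data `P` with
`P.IsThePerfection hF`. No statement of the paper is strengthened.
-/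

noncomputable section

namespace Literature.AlgebraicGeometry.Frobenioids

namespace PreFrobenioid

open CategoryTheory Opposite

universe w v v' u u'

variable {D : Type u} [Category.{v} D] {Φ : Dᵒᵖ ⥤ CommMonCat.{w}}
  {C : Type u'} [Category.{v'} C] {F : C ⥤ ElemFrobenioid Φ}

/-- **"`P` is the perfection of `C`"** (FrdI Def. 3.1 (iii) p. 57, Prop. 3.2 (i) p. 58): the perfection datum
`P` over the operations of the Frobenioid `F : C → F_Φ` is identified with THE constructed perfection
`C^pf` of abc-iut-L1-d9 by an equivalence `e : P.Pf ≌ C^pf` carrying `P.toPf` to `C → C^pf` and the roots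
`P.root A n` to `(A, n)`, under which the operations agree: `Base` (via `β`), `deg_Fr`, the divisor monoids
(monoid isomorphisms `μ_X : Φ_P(X) ≃ Φ^pf(X)` natural in pull-backs) and `Div` (`Div^pf(e f) = β_X^* μ(Div_P f)`).
[cite: MochizukiFrdI2008, Def. 3.1 (iii) p.57] -/
structure _root_.Literature.AlgebraicGeometry.Frobenioids.PerfectionData.IsThePerfection
    (hF : IsFrobenioid F) (P : PerfectionData (PreFrobenioidData.ofFunctor Φ F)) : Prop where
  /-- the identification with the constructed perfection, compatible with all the structure -/
  out : ∃ (e : P.Pf ≌ Perfection hF) (_ : P.toPf ⋙ e.functor ≅ Perfection.toPf hF)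
      (β : e.functor ⋙ (Perfection.ops hF).base ≅ P.ops.base)
      (μ : ∀ X : D, P.ops.Mon X ≃* (Perfection.ops hF).Mon X),
    (∀ (A : C) (n : ℕ+), Nonempty (e.functor.obj (P.root A n) ≅ Perfection.root hF A n)) ∧
      (∀ ⦃X Y : P.Pf⦄ (f : X ⟶ Y), (Perfection.ops hF).degFr (e.functor.map f) = P.ops.degFr f) ∧
      (∀ ⦃X Y : D⦄ (g : Y ⟶ X) (x : P.ops.Mon X),
          μ Y (P.ops.pull g x) = (Perfection.ops hF).pull g (μ X x)) ∧
      ∀ ⦃X Y : P.Pf⦄ (f : X ⟶ Y),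
        (Perfection.ops hF).div (e.functor.map f) =
          (Perfection.ops hF).pull (β.hom.app X) (μ _ (P.ops.div f))

/-- **THE constructed perfection is the perfection** (PROVED: identity equivalence, identity isomorphisms).
[cite: MochizukiFrdI2008, Def. 3.1 (iii) p.57] -/
theorem isThePerfection_perfection (hF : IsFrobenioid F) :
    (PreFrobenioidData.perfection hF).IsThePerfection hF := by
  refine ⟨CategoryTheory.Equivalence.refl, Functor.rightUnitor _, Functor.leftUnitor _, fun X => MulEquiv.refl _,
    fun A n => ⟨Iso.refl _⟩, fun X Y f => rfl, fun X Y g x => rfl, fun X Y f => ?_⟩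
  change (Perfection.ops hF).div f = (Perfection.ops hF).pull (𝟙 _) ((Perfection.ops hF).div f)
  exact ((Perfection.ops hF).pull_id _ _).symm

end PreFrobenioid

end Literature.AlgebraicGeometry.Frobenioids

end
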